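import Summits.BirchSwinnertonDyer.BirchSwinnertonDyer.Theses.PAdicOrderV2
import Literature.NumberTheory.EllipticCurves.PAdicLFunctionDistributionHoldsProofs
import Literature.NumberTheory.EllipticCurves.ModularSymbolsCompletedLProofs
import Literature.NumberTheory.EllipticCurves.ModularFormsGamma0Genus
import Literature.NumberTheory.EllipticCurves.AnalyticRankModularityProofs
import Literature.NumberTheory.EllipticCurves.AnalyticRankOrderProofs

/-!
# BirchSwinnertonDyer / PAdicOrderV2 — crux `PAdicOrderComparisonR2` (stmt-BirchSwinnertonDyer-0489),
# line `Sketch`, stub `stub_constantCoeff_eq_zero_iff`: `L_p(E, 0) = 0 ↔ 1 ≤ ord_{s=1} L(E, s)`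

Registered stub S1 (the interpolation leg) of the order-split skeleton
`Cruxes/PAdicOrderComparisonR2/Lines/Sketch.lean`: for `E/ℚ` (globally minimal `W`), a good
ordinary prime `p` and the newform `f` of `E` (any level `N`), the constant term of the
Mazur–Swinnerton-Dyer `p`-adic `L`-function `L_p(E, T) = padicLFunction f (unitRoot W p)`
vanishes iff the analytic rank of `E` is positive.

Proof (Mazur–Tate–Teitelbaum 1986, §I.14, (14.3) at the trivial character), entirely from PROVED
tree theorems:
* `L_p(E, 0) = (1 - α⁻¹)² [0]⁺_f` (`isPAdicLFunctionOf_padicLFunction_holds`, first clause);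
* `α ≠ 1`: otherwise `a_p = p + 1`, i.e. `#Ẽ(𝔽_p) = 0`, but the reduction has the point `O`
  (`unitRoot_coe_spec`, `WeierstrassCurve.reductionPointCount_pos`);
* `([0]⁺_f : ℝ) = re L(f, 1) / Ω⁺_f` with `Ω⁺_f > 0` (`ratCast_ratPlusSymbol_holds`,
  `normalizedPlusSymbol_zero_holds`, `IsNewform0.plusPeriod_pos_holds`), for Hecke's entire
  continuation `L` of `L(f, s)` (`exists_differentiable_eq_cuspFormLSeries_of_lt_re`);
* `L(f, 1) ∈ ℝ` (`modularSymbol_zero_eq_holds`, `modularSymbol_neg_eq_conj_holds`: the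
  coefficients `aₙ(f) = aₙ(E)` are rational);
* `L = L(E, ·)` (`WeierstrassCurve.hasEntireLFunction_of_cuspCoeff_eq`, uniqueness of the entire
  continuation `WeierstrassCurve.subsingleton_entireContinuations`) and
  `r_an = 0 ↔ L(E, 1) ≠ 0` (`WeierstrassCurve.analyticRank_eq_zero_iff_holds`).
No named fact is taken as a hypothesis; `p = 2` is allowed. Deliberately NOT here: the other
stubs of the line (parity, the Kato leg, the non-degeneracy legs).
-/

-- single-conjunct summit: `Summit.BirchSwinnertonDyer.BirchSwinnertonDyer.…` repeats the name by design
set_option linter.dupNamespace false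

namespace Summit.BirchSwinnertonDyer.BirchSwinnertonDyer.Theorems

open Literature.NumberTheory.EllipticCurves Literature.NumberTheory.EllipticCurves.ModularForms

/-- **The unit root is not `1`.** At a good ordinary prime `p` of a globally minimal `W/ℚ`, the
unit root `α` of `X² - a_p X + p` satisfies `α ≠ 1` in `ℚ_p`: otherwise `1 - a_p + p = 0`, i.e.
`a_p = p + 1 - #Ẽ(𝔽_p)` forces `#Ẽ(𝔽_p) = 0`, while the reduction always has the point `O`
(`WeierstrassCurve.reductionPointCount_pos`). This is the non-vanishing of the Euler-type factor
`(1 - α⁻¹)²` of the interpolation formula at a good prime (Mazur–Tate–Teitelbaum 1986, §I.14).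
[cite: MazurTateTeitelbaum1986Invent, §I.14] -/
theorem s1_unitRoot_coe_ne_one (W : WeierstrassCurve ℚ) [W.IsGloballyMinimal] (p : ℕ)
    [Fact p.Prime] (hord : IsOrdinaryAt W p) : (unitRoot W p : ℚ_[p]) ≠ 1 := by
  intro h1
  obtain ⟨hαeq, -, -⟩ := unitRoot_coe_spec (W := W) hord
  rw [h1] at hαeq
  haveI : NeZero p := ⟨(Fact.out : p.Prime).ne_zero⟩
  have hcount : 0 < W.reductionPointCount p := W.reductionPointCount_pos p
  unfold WeierstrassCurve.frobeniusTrace at hαeq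
  push_cast at hαeq
  have h0 : ((W.reductionPointCount p : ℕ) : ℚ_[p]) = 0 := by linear_combination hαeq
  exact hcount.ne' (by exact_mod_cast h0)

/-- **`[0]⁺_f = 0 ↔ L(1) = 0`** for the newform `f` of `W/ℚ` and any entire continuation `L` of
`L(f, s)` from `re s > 2`: `([0]⁺_f : ℝ) = re L(1) / Ω⁺_f` (`ratCast_ratPlusSymbol_holds`,
`normalizedPlusSymbol_zero_holds`; Mazur–Tate–Teitelbaum 1986, §I.8, (8.6): `[0]⁺ = L(f,1)/Ω⁺`),
`Ω⁺_f > 0` (`IsNewform0.plusPeriod_pos_holds`), and `L(1) = {∞, 0}_f` is real because the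
coefficients of `f` are rational (`modularSymbol_zero_eq_holds`, `modularSymbol_neg_eq_conj_holds`).
[cite: MazurTateTeitelbaum1986Invent, §I.8 (8.6)] -/
theorem s1_ratPlusSymbol_zero_eq_zero_iff {W : WeierstrassCurve ℚ} {N : ℕ} [NeZero N]
    {f : CuspForm (CongruenceSubgroup.Gamma0 N) 2} (hf : IsNewformOf W f) {L : ℂ → ℂ}
    (hL : Differentiable ℂ L) (hL2 : ∀ s : ℂ, 2 < s.re → L s = cuspFormLSeries f s) :
    ratPlusSymbol f 0 = 0 ↔ L 1 = 0 := by
  have hQ : coeffField f = ⊥ := hf.coeffField_eq_bot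
  have hreal : ∀ n, (cuspCoeff f n).im = 0 := cuspCoeff_im_eq_zero_of_coeffField_eq_bot hQ
  have hrat : ((ratPlusSymbol f 0 : ℚ) : ℝ) = (L 1).re / plusPeriod f := by
    rw [ratCast_ratPlusSymbol_holds hf.1 hQ 0]
    exact normalizedPlusSymbol_zero_holds f hreal hL hL2
  have hpos : 0 < plusPeriod f := IsNewform0.plusPeriod_pos_holds hf.1 hQ
  have him : (L 1).im = 0 := by
    have h := modularSymbol_neg_eq_conj_holds f hreal 0
    rw [neg_zero, modularSymbol_zero_eq_holds f hL hL2] at h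
    exact Complex.conj_eq_iff_im.mp h.symm
  rw [← Rat.cast_eq_zero (α := ℝ), hrat, div_eq_zero_iff, or_iff_left hpos.ne']
  constructor
  · intro h
    exact Complex.ext (by rw [h, Complex.zero_re]) (by rw [him, Complex.zero_im])
  · intro h
    rw [h, Complex.zero_re]

/-- **Stub S1 of line `Sketch` (crux `PAdicOrderComparisonR2`, stmt-BirchSwinnertonDyer-0489):
at a good ordinary prime, `L_p(E, 0) = 0 ↔ 1 ≤ ord_{s=1} L(E, s)`.** For `E/ℚ` (globally minimal
`W`), `p` good ordinary and `f` the newform of `E`: the constant term of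
`L_p(E, T) = padicLFunction f (unitRoot W p)` is `(1 - α⁻¹)² [0]⁺_f`
(`isPAdicLFunctionOf_padicLFunction_holds`; Mazur–Tate–Teitelbaum 1986, §I.14, (14.3) at the
trivial character), `α ≠ 1` (`s1_unitRoot_coe_ne_one`), `[0]⁺_f = 0 ↔ L(f, 1) = 0`
(`s1_ratPlusSymbol_zero_eq_zero_iff`, for Hecke's entire continuation of `L(f, s)`,
`exists_differentiable_eq_cuspFormLSeries_of_lt_re`), that continuation is `L(E, s)`
(`WeierstrassCurve.hasEntireLFunction_of_cuspCoeff_eq`,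
`WeierstrassCurve.subsingleton_entireContinuations`), and `r_an = 0 ↔ L(E, 1) ≠ 0`
(`WeierstrassCurve.analyticRank_eq_zero_iff_holds`). [cite: MazurTateTeitelbaum1986Invent, §I.14 (14.3)] -/
theorem stub_constantCoeff_eq_zero_iff : ∀ (W : WeierstrassCurve ℚ) [W.IsElliptic] [W.IsGloballyMinimal] (p : ℕ) [Fact p.Prime], Literature.NumberTheory.EllipticCurves.IsOrdinaryAt W p → ∀ {N : ℕ} [NeZero N] (f : CuspForm (CongruenceSubgroup.Gamma0 N) 2), Literature.NumberTheory.EllipticCurves.ModularForms.IsNewformOf W f → (PowerSeries.constantCoeff (Literature.NumberTheory.EllipticCurves.padicLFunction f (Literature.NumberTheory.EllipticCurves.unitRoot W p : ℚ_[p])) = 0 ↔ 1 ≤ W.analyticRank) := by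
  intro W _ _ p _ hord N _ f hf
  -- Hecke's entire continuation `L` of `L(f, s)` (agreement on `re s > 3/2`)
  obtain ⟨L, hL, hLeq⟩ :=
    exists_differentiable_eq_cuspFormLSeries_of_lt_re (CongruenceSubgroup.strictWidthInfty_Gamma0 N) f
  have hL2 : ∀ s : ℂ, 2 < s.re → L s = cuspFormLSeries f s :=
    fun s hs ↦ hLeq s (by push_cast; linarith)
  -- `L = L(E, ·)`: both are entire continuations of `L(E, s)` from `re s > 3/2`
  have hE : W.HasEntireLFunction :=
    WeierstrassCurve.hasEntireLFunction_of_cuspCoeff_eq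
      (CongruenceSubgroup.strictWidthInfty_Gamma0 N) W f hf.2
  have hLmem : L ∈ W.entireContinuations :=
    ⟨hL, fun s hs ↦ by rw [hLeq s (by push_cast; linarith), hf.cuspFormLSeries_eq]⟩
  have hLW : L = W.entireLFunction :=
    W.subsingleton_entireContinuations hLmem (W.entireLFunction_mem hE)
  -- the Euler-type factor `(1 - α⁻¹)²` is non-zero
  have hfac : ((1 : ℚ_[p]) - (unitRoot W p : ℚ_[p])⁻¹) ^ 2 ≠ 0 := by
    refine pow_ne_zero _ (sub_ne_zero.mpr fun h ↦ ?_)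
    exact s1_unitRoot_coe_ne_one W p hord (inv_eq_one.mp h.symm)
  -- the interpolation formula for the constant term
  have hconst : PowerSeries.constantCoeff (padicLFunction f (unitRoot W p : ℚ_[p])) =
      (1 - (unitRoot W p : ℚ_[p])⁻¹) ^ 2 * (ratPlusSymbol f 0 : ℚ_[p]) :=
    (isPAdicLFunctionOf_padicLFunction_holds hord hf).1
  rw [hconst, mul_eq_zero, or_iff_right hfac, Rat.cast_eq_zero, Nat.one_le_iff_ne_zero, Ne,
    WeierstrassCurve.analyticRank_eq_zero_iff_holds (W := W) hE, not_not, ← hLW]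
  exact s1_ratPlusSymbol_zero_eq_zero_iff hf hL hL2

end Summit.BirchSwinnertonDyer.BirchSwinnertonDyer.Theorems
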